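import Mathlib
import Summits.NavierStokesRegularity.NavierStokesRegularity.Theses.EulerZoomLiouville
import Summits.NavierStokesRegularity.NavierStokesRegularity.Theorems.EulerZoomLiouvillePowerGaugeEulerLiouvilleLargeRho
import Summits.NavierStokesRegularity.NavierStokesRegularity.Theorems.EulerZoomLiouvillePowerGaugeEulerLiouvillePastIrrotational
import Summits.NavierStokesRegularity.NavierStokesRegularity.Theorems.EulerZoomLiouvillePowerGaugeEulerLiouvilleSwirlfreeLedgerDecay
import Summits.NavierStokesRegularity.NavierStokesRegularity.Theorems.EulerZoomLiouvillePowerGaugeEulerLiouvilleSwirlfreeLedgerFlow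
import Summits.NavierStokesRegularity.NavierStokesRegularity.Theorems.EulerZoomLiouvillePowerGaugeEulerLiouvilleSwirlfreeLedgerConfinement
import Literature.Analysis.FluidPDE.AxisymmetricEuler
import Literature.Analysis.FluidPDE.ClassicalSolution
import Literature.Analysis.FluidPDE.VectorCalculus
import HarnessLib.Audit

/-!
# Line `casimir-floor` (ideator ns-idea-11 g3, lens «complete» = program-completion) for the crux
# `EulerZoomLiouville.PowerGaugeEulerLiouville` (stmt-NavierStokesRegularity-19832)

PROGRAMME COMPLETED.  Two author-named gaps at once.
(1) Seregin, arXiv:2606.29468 §4, Prop. 4.1 / remark p. 13 ("could be used for further analysis of ancient solutions to the Euler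
    equations"): the material quantity `η = ω_θ / r` of the axisymmetric swirl-free zoom limit.  g0's line `swirlfree-ledger` (L1, FILLED
    except its residue) used ONE functional of `η` — the `q`-ledger `∫ η^q`, `q < 1`, against Hölder — and its reach STOPS at the drift exponent
    `κ > 1/2` (`‖u(τ)‖_∞ ≤ M(−τ)^{−κ}`): its confinement stub S2 needs the parcels of a late ball inside `B(a)` during the WHOLE window
    `(−a², t₀)`, and even with partial windows the Hölder ledger cannot pass `κ = (2−ρ)/(4−ρ)` (see the card).  L1's docstring names this
    boundary itself ("sub-parabolic rate … κ > 1/2").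
(2) This line supplies the missing second functional: the TRANSPORTED SUPREMUM `sup_T η` of a material blob `T` together with its transported
    MASS `∫_T η dx` (both exact Casimirs of classical swirl-free axisymmetric Euler: `D_t η = 0`, `det Dφ = 1`), and converts the pair into an
    ENSTROPHY FLOOR by convex duality against the azimuthal potential `s/r`:
        `∫_T |curl u|² ≥ 2 s ∫_T η − ∫_{B(a)} ψ_{W r}(s/r) dx ≥ m² / (8π a (2 + log⁺(a³ W / m)))`        (CASIMIR FLOOR)
    for every blob `T ⊂ B(a)` with `η ≤ W` on `T` and `∫_T η ≥ m` (pointwise `c² ≥ 2 c v − ψ_B(v)` for `0 ≤ c ≤ B`, `ψ_B(v) = v²` if `v ≤ B`,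
    `2Bv − B²` otherwise; the cylindrical shell integral `∫_{B(a)} ψ_{Wr}(s/r) ≤ π a s² (3 + 2 log(a² W / s))`; optimise `s = m/(8π a L)`).
    The floor is LOG-LOSSLESS in `a` (power `a^{−1}`), whereas the `E`-gauge budget of the class is `∫_{−a²}^{0}∫_{B(a)} |∇u|² ≤ c a^{1−ρ}`:
    a blob of ledger mass `m > 0` can stay inside `B(a)` only for `O(a^{2−ρ} log a)` of the `a²` units of window time.  Under the drift
    hypothesis with exponent `κ` the blob of a late ball is inside `B(a)` during `(−T_a, t₀)`, `T_a ≍ min(a², a^{1/(1−κ)})`, and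
    `a^{1/(1−κ)} ≫ a^{2−ρ} log a` exactly when `κ > (1−ρ)/(2−ρ)` — a threshold `< 1/2` for every `ρ > 0` (`= 1/3` at `ρ = 1/2`).
    Contradiction ⇒ `curl u ≡ 0` on the past ⇒ the lead's LANDED filler `PastIrrotational.ae_eq_zero_of_gauge_of_pastIrrotational`.

THE STRATUM (strictly larger than L1's): classical axisymmetric swirl-free members with `‖u(τ,x)‖ ≤ M (−τ)^{−κ}` for some
`κ ∈ ((1−ρ)/(2−ρ), 1)` (L1: `κ > 1/2`; the overlap `κ ∈ (1/2,1)` is re-proved here by the new lever, NOT by importing L1's stubs; a member with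
`κ ≥ 1` satisfies the bound with any smaller exponent on `τ ≤ −1`, which is all the endgame uses — see K3).

THE LEVER (new on this crux — checked against `birth` v36, `rungC_window`, the five ideator lines and the 301 Theorems files: nobody uses the
`L^∞` Casimir of `η` or a duality floor): K2 `stub_casimirFloor`.  K1 `stub_blobTransport` is L1's transport/confinement infrastructure re-cut to
PARTIAL windows and arbitrary late blobs (landed pieces: `omegaTilde_evolutionMap_eq`, `norm_evolutionMap_sub_le` (any `κ₀ < 1`),
`det_fderiv_evolutionMap_eq_one_of_divergence`, `lintegral_comp_evolutionMap_le`, `div_cylRadius_eq_abs_omegaTilde`); K3 `stub_floorEndgame` is the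
exponent bookkeeping above + `setLIntegral_window_frobenius_fderiv_le` + `sq_norm_curl_le_frobeniusNormSq` + the landed irrotational filler;
K4 `stub_fastDriftRest` is the honest OPEN residue (members outside the stratum; contains `birth`'s open stubs minus the stratum) — NOT claimed.
The composition `PowerGaugeEulerLiouville_of` is kernel-checked (no sorry of its own); sorries live only in `stub_*`.
DISTANCE LABEL (idea-crit-8 V casimir-floor P1, verbatim): deliverable = the STRATUM theorem «classical axisymmetric swirl-free members of the
ρ-class with backward sup-decay exponent κ ∈ ((1−ρ)/(2−ρ), 1) are trivial», residue K4 (non-classical / swirl / κ ≤ (1−ρ)/(2−ρ)) is crux-sized and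
NOT claimed — zero width on K4.  PROVER ORDER (P2): ONE prover, K2 (pure real analysis, reusable Literature-grade lemma) → K1 (re-cut of p609539 to
partial windows / off-centre balls) → K3.  (P3) when K2 lands, state it for measurable `T` and `C¹` `v` exactly as typed (no div-free needed).
Crux 19832, N0 and NS regularity stay OPEN.  No summit is proved by a line.
-/

open MeasureTheory Set Filter Topology Metric Real
open scoped ENNReal NNReal
open Literature.Analysis Literature.Analysis.FluidPDE

set_option linter.dupNamespace false

namespace Summit.NavierStokesRegularity.NavierStokesRegularity.Cruxes.PowerGaugeEulerLiouville.CasimirFloor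

/-- Local abbreviation: ℝ³. -/
abbrev E3 : Type := EuclideanSpace ℝ (Fin 3)

/-- Membership in Seregin's power-gauged ancient Euler class — verbatim the three hypotheses of the crux (same as `Birth.InClass`). -/
@[reducible] def InClass (ρ : ℝ) (u : ℝ → E3 → E3) (p : ℝ → E3 → ℝ) (H : ℝ → E3 → E3 →L[ℝ] E3)
    (c : ℝ≥0) : Prop :=
  IsSuitableWeakSolutionOn (slab (EuclideanSpace ℝ (Fin 3)) (Set.Iio 0) isOpen_Iio) 0 0 u p ∧
    HasWeakSpatialGradientOn (slab (EuclideanSpace ℝ (Fin 3)) (Set.Iio 0) isOpen_Iio) u H ∧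
    (∀ a : ℝ, 0 < a →
      ENNReal.ofReal (a ^ (2 * ρ)) * cknA a (0 : ℝ × E3) u + ENNReal.ofReal (a ^ ρ) * cknE a (0 : ℝ × E3) H +
        ENNReal.ofReal (a ^ (2 * ρ)) * cknD a (0 : ℝ × E3) p ≤ (c : ℝ≥0∞))

/-- The conclusion of the crux: `u` vanishes a.e. on the past slab. -/
@[reducible] def VanishesAE (u : ℝ → E3 → E3) : Prop :=
  Function.uncurry u =ᵐ[volume.restrict (Set.Iio (0 : ℝ) ×ˢ (Set.univ : Set E3))] 0

/-- The axis ledger density `η(v)(x) = |curl v (x)| / r(x)` (`r` = distance to the symmetry axis; junk value `0` on the axis, a null set);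
`= |ω_θ| / r` for swirl-free axisymmetric fields (`div_cylRadius_eq_abs_omegaTilde`), materially conserved by classical swirl-free
axisymmetric Euler flows (Majda–Bertozzi §2.3.3; `omegaTilde_transport`).  Same formula as L1's `SwirlfreeLedger.axisLedger`
(restated, not imported: lines do not share declarations). -/
noncomputable def axisLedger (v : E3 → E3) (x : E3) : ℝ :=
  ‖curl v x‖ / cylRadius x

/-- Backward drift radius of the velocity bound `‖u(s,·)‖_∞ ≤ M (−s)^{−κ}` between times `t₁ < t₀ < 0` (`κ < 1`):
`M ((−t₁)^{1−κ} − (−t₀)^{1−κ}) / (1−κ)` — the bound of `norm_evolutionMap_sub_le`. -/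
noncomputable def driftRadius (M κ t₀ t₁ : ℝ) : ℝ :=
  M / (1 - κ) * ((-t₁) ^ (1 - κ) - (-t₀) ^ (1 - κ))

/-- Classical axisymmetric swirl-free member WITH explicit drift data `(M, κ)`: classical Euler on `(−∞,0) × ℝ³`, axisymmetric swirl-free
slices, `0 ≤ M`, `κ < 1`, and `‖u(τ,x)‖ ≤ M (−τ)^{−κ}` for all `τ < 0`. -/
def IsSwirlFreeDriftingWith (u : ℝ → E3 → E3) (p : ℝ → E3 → ℝ) (M κ : ℝ) : Prop :=
  IsClassicalEulerSolutionOn (Set.Iio 0) 0 u p ∧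
    (∀ τ : ℝ, τ < 0 → IsAxisymmetric (u τ) ∧ HasNoSwirl (u τ)) ∧
    0 ≤ M ∧ κ < 1 ∧ ∀ τ : ℝ, τ < 0 → ∀ x : E3, ‖u τ x‖ ≤ M * (-τ) ^ (-κ)

/-- THE STRATUM (depends on `ρ` through the threshold): drift exponent `κ ∈ ((1−ρ)/(2−ρ), 1)`.  L1's stratum is the sub-case `κ > 1/2`
(note `(1−ρ)/(2−ρ) < 1/2 ⇔ ρ > 0`). -/
def IsSwirlFreeSlowDrifting (ρ : ℝ) (u : ℝ → E3 → E3) (p : ℝ → E3 → ℝ) : Prop :=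
  ∃ M κ : ℝ, (1 - ρ) / (2 - ρ) < κ ∧ IsSwirlFreeDriftingWith u p M κ

/-- LEDGER BLOBS PERSIST BACKWARD (the conclusion shape of K1): every late off-axis blob `B(x₀, δ)` at time `t₀ < 0` on which the ledger density
is `≤ W` has, at every earlier time `t₁`, a measurable avatar `T ⊆ B(0, ‖x₀‖ + δ + driftRadius M κ t₀ t₁)` on which the density is still `≤ W`
and whose ledger mass is at least that of the blob (in truth: `T` = backward flow image, density transported, mass equal). -/
def LedgerBlobsPersist (u : ℝ → E3 → E3) (M κ : ℝ) : Prop :=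
  ∀ t₀ : ℝ, t₀ < 0 → ∀ (x₀ : E3) (δ W : ℝ), 0 < δ → δ < cylRadius x₀ →
    (∀ x ∈ ball x₀ δ, axisLedger (u t₀) x ≤ W) →
    ∀ t₁ : ℝ, t₁ < t₀ →
      ∃ T : Set E3, MeasurableSet T ∧ T ⊆ ball (0 : E3) (‖x₀‖ + δ + driftRadius M κ t₀ t₁) ∧
        (∀ x ∈ T, axisLedger (u t₁) x ≤ W) ∧
        ∫⁻ x in ball x₀ δ, ENNReal.ofReal (axisLedger (u t₀) x) ≤ ∫⁻ x in T, ENNReal.ofReal (axisLedger (u t₁) x)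

/-- THE CASIMIR FLOOR (the new lever, one time slice, no PDE): a `C¹` field `v`, a measurable blob `T ⊆ B(0,a)` on which `|curl v| ≤ W · r`
(i.e. ledger density `≤ W`) and whose ledger mass `∫_T |curl v|/r` is at least `m > 0` carries enstrophy
`∫_T |curl v|² ≥ m² / (8 π a (2 + log⁺ (a³ W / m)))`. -/
def CasimirFloor : Prop :=
  ∀ (v : E3 → E3) (T : Set E3) (a W m : ℝ), ContDiff ℝ 1 v → 0 < a → 0 < W → 0 < m → MeasurableSet T →
    T ⊆ ball (0 : E3) a → (∀ x ∈ T, axisLedger v x ≤ W) →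
    ENNReal.ofReal m ≤ ∫⁻ x in T, ENNReal.ofReal (axisLedger v x) →
      ENNReal.ofReal (m ^ 2 / (8 * π * a * (2 + max 0 (Real.log (a ^ 3 * W / m))))) ≤
        ∫⁻ x in T, ENNReal.ofReal (‖curl v x‖ ^ 2)

/-! ## Registered stub signatures -/

/-- Signature of `stub_blobTransport` (K1, size M): classical swirl-free axisymmetric members with drift data `(M, κ)`, `κ < 1`, have persistent
ledger blobs — localised particle flow of the cut-off field (`isUniformlyLipschitzOn_bump_smul`), backward displacement
`≤ driftRadius M κ t₀ t₁` (`norm_evolutionMap_sub_le`, any `κ₀ < 1`), axis invariance (`cylRadius_evolutionMap_ne_zero`), transport of `ω_θ/r`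
along off-axis trajectories (`omegaTilde_evolutionMap_eq` + `div_cylRadius_eq_abs_omegaTilde`: density `≤ W` persists pointwise), `det Dφ = 1`
(`det_fderiv_evolutionMap_eq_one_of_divergence`) + change of variables (`lintegral_comp_evolutionMap_le`): mass persists.  L1's S2
(`materialConfinement_of_swirlFreeDrifting`, p609539) is the full-window, centred-ball, `q`-power special case. -/
def Sig.stub_blobTransport : Prop :=
  ∀ (u : ℝ → E3 → E3) (p : ℝ → E3 → ℝ) (M κ : ℝ), IsSwirlFreeDriftingWith u p M κ → LedgerBlobsPersist u M κ

/-- Signature of `stub_casimirFloor` (K2, size M, THE NEW LEVER): the Casimir floor.  Proof: pointwise for `0 ≤ c ≤ B` and `v ≥ 0`,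
`c² ≥ 2 c v − ψ_B(v)` with `ψ_B(v) = v²` (`v ≤ B`), `2Bv − B²` (`v > B`); take `c = |curl v(x)|`, `B = W r(x)`, `v = s/r(x)`: `2cv = 2 s η(x)`; integrate
over `T`, enlarge the `ψ`-integral to `B(0,a) ⊆ {r ≤ a} × {|x₃| ≤ a}` and compute in cylindrical shells
`∫ ψ ≤ 4π a [∫_0^{√(s/W)} (2Ws − W²r²) r dr + ∫_{√(s/W)}^{a} s²/r dr] = π a s² (3 + 2 log (a² W / s))` (`s ≤ a² W`, automatic from
`m ≤ (4/3)π a³ W`); choose `s = m / (8π a L)`, `L = 2 + log⁺(a³W/m)`, and check `3 + 2 log(8π) + 2 log(a³W/m) + 2 log L ≤ 8 L`. -/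
def Sig.stub_casimirFloor : Prop := CasimirFloor

/-- Signature of `stub_floorEndgame` (K3, size M): GIVEN the Casimir floor, a member of the class (`0 < ρ ≤ 1/2`) on the stratum with persistent
ledger blobs is trivial.  Proof: if `curl (u t₀) x₀ ≠ 0` for some `t₀ < 0` (wlog `t₀ ≤ −1`) and `x₀` off the axis (else `curl ≡ 0` by continuity,
the axis being nowhere dense), take `δ < r(x₀)/2`, `W = sup_{B(x₀,δ)} η < ∞`, `m = ∫_{B(x₀,δ)} η > 0`; for `a` large and every
`t₁ ∈ (−T_a, t₀)`, `T_a := min (a², c_κ (a/M)^{1/(1−κ)})`, the avatar `T ⊆ B(0,a)` (K1) has enstrophy `≥ m²/(8π a (2 + log⁺(a³W/m)))` (floor);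
integrate in `t₁` and compare with `∫_{−a²}^{0}∫_{B(a)} |curl u|² ≤ 2 c a^{1−ρ}` (`setLIntegral_window_frobenius_fderiv_le`,
`sq_norm_curl_le_frobeniusNormSq`): `(T_a − |t₀|) m² ≤ 16 π c a^{2−ρ} (2 + 3 log a + log(W/m))`, impossible as `a → ∞` because
`min(2, 1/(1−κ)) > 2 − ρ` iff `κ > (1−ρ)/(2−ρ)` (for `κ ≥ 1/2` use `T_a = a²`).  Hence `curl u ≡ 0` on `(−∞,0) × ℝ³` and the landed
`PastIrrotational.ae_eq_zero_of_gauge_of_pastIrrotational` (`T₁ = 0`; `C²` slices and `div u = 0` from the classical structure) concludes. -/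
def Sig.stub_floorEndgame : Prop :=
  CasimirFloor →
    ∀ ρ : ℝ, 0 < ρ → ρ ≤ 1 / 2 → ∀ (u : ℝ → E3 → E3) (p : ℝ → E3 → ℝ) (H : ℝ → E3 → E3 →L[ℝ] E3) (c : ℝ≥0),
      InClass ρ u p H c → ∀ M κ : ℝ, (1 - ρ) / (2 - ρ) < κ → IsSwirlFreeDriftingWith u p M κ →
        LedgerBlobsPersist u M κ → VanishesAE u

/-- Signature of `stub_fastDriftRest` (K4, OPEN, crux-sized — NOT claimed by this line): in the window `0 < ρ ≤ 1/2`, members OUTSIDE the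
stratum (not classical, or not axisymmetric swirl-free, or with drift exponent `κ ≤ (1−ρ)/(2−ρ)` only) are trivial.  This is where `birth`'s
open stubs live, minus the stratum; it is strictly SMALLER than L1's residue `stub_driftlessRest`. -/
def Sig.stub_fastDriftRest : Prop :=
  ∀ ρ : ℝ, 0 < ρ → ρ ≤ 1 / 2 → ∀ (u : ℝ → E3 → E3) (p : ℝ → E3 → ℝ) (H : ℝ → E3 → E3 →L[ℝ] E3) (c : ℝ≥0),
    InClass ρ u p H c → ¬ IsSwirlFreeSlowDrifting ρ u p → VanishesAE u

/-! ## Stubs -/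

/-- STUB K1 [provable, M]. -/
theorem stub_blobTransport : Sig.stub_blobTransport := by
  sorry

/-- STUB K2 [provable, M; the new lever]. -/
theorem stub_casimirFloor : Sig.stub_casimirFloor := by
  sorry

/-- STUB K3 [provable, M]. -/
theorem stub_floorEndgame : Sig.stub_floorEndgame := by
  sorry

/-- STUB K4 [OPEN residue, not claimed]. -/
theorem stub_fastDriftRest : Sig.stub_fastDriftRest := by
  sorry

/-! ## Sanity checks on the stratum arithmetic (kernel-checked) -/

/-- The threshold is below L1's `1/2` for every `ρ > 0` (with `ρ < 2`): the stratum strictly extends `swirlfree-ledger`. -/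
theorem threshold_lt_half {ρ : ℝ} (hρ : 0 < ρ) (hρ2 : ρ < 2) : (1 - ρ) / (2 - ρ) < 1 / 2 := by
  rw [div_lt_div_iff₀ (by linarith) (by norm_num)]
  linarith

/-- At the energy endpoint `ρ = 1/2` the threshold is `1/3`. -/
example : (1 - (1 / 2 : ℝ)) / (2 - 1 / 2) = 1 / 3 := by norm_num

/-- The exponent race behind K3: for `κ < 1`, `1/(1−κ) > 2 − ρ ↔ κ > (1−ρ)/(2−ρ)` (here `ρ < 2`). -/
theorem exponent_race {ρ κ : ℝ} (hκ : κ < 1) (hρ2 : ρ < 2) :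
    2 - ρ < 1 / (1 - κ) ↔ (1 - ρ) / (2 - ρ) < κ := by
  have h1 : 0 < 1 - κ := by linarith
  have h2 : 0 < 2 - ρ := by linarith
  rw [lt_div_iff₀ h1, div_lt_iff₀ h2]
  constructor <;> intro h <;> nlinarith

/-! ## Composition -/

/-- **Composition (kernel-checked, no sorry of its own): the four stubs give the crux BY NAME.** -/
theorem PowerGaugeEulerLiouville_of :
    Sig.stub_blobTransport → Sig.stub_casimirFloor → Sig.stub_floorEndgame → Sig.stub_fastDriftRest →
      Summit.NavierStokesRegularity.NavierStokesRegularity.Theses.EulerZoomLiouville.PowerGaugeEulerLiouville := by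
  intro h1 h2 h3 h4 ρ hρ u p H c hsw hH hc
  by_cases hhalf : 1 / 2 < ρ
  · exact
      Summit.NavierStokesRegularity.NavierStokesRegularity.Theorems.PowerGaugeEulerLiouville.powerGaugeEulerLiouville_largeRho
        ρ hhalf u p H c hsw hH hc
  · have hρ2 : ρ ≤ 1 / 2 := not_lt.mp hhalf
    by_cases hS : IsSwirlFreeSlowDrifting ρ u p
    · obtain ⟨M, κ, hκ, hW⟩ := hS
      exact h3 h2 ρ hρ hρ2 u p H c ⟨hsw, hH, hc⟩ M κ hκ hW (h1 u p M κ hW)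
    · exact h4 ρ hρ hρ2 u p H c ⟨hsw, hH, hc⟩ hS

end Summit.NavierStokesRegularity.NavierStokesRegularity.Cruxes.PowerGaugeEulerLiouville.CasimirFloor
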